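import Summits.QuantumAdvantage.QuantumAdvantage.Theorems.ShadowDialA

/-! # ShadowDialB — part 2/4 of the landing twins of NODE «ShadowDial» (decomp-qadv lens-2 g24; node file
`g24/ShadowDial.lean`, sha256 c1ef15d9c22c1bbf…; generator `g24/tree/gen_twins.py`: namespace `Theses.ShadowDial` →
`Theorems.ShadowDial`, cut at section boundaries, docstrings added where missing, docstring-only import `AffBells22FrameJunta` dropped,
nothing else).
Content: §4 the `𝔽₂`-DEGREE CERTIFICATE ENGINE (`cube_sum_eq_zero_of_lowDeg` — Möbius top coefficient; `rc` parity lemmas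
`rc_insert` / `rc_mod_two` / `rc_zero_odd`) and the TERNARY certificate of the g23 matching family `qStrat`: its last output bit has
LINEAR `𝔽₂`-degree at the zero gauge (`q_shadow_not_lowDeg`, `q_shadow_degree_linear`, `q_not_F2low_zero`). -/

set_option linter.dupNamespace false
noncomputable section
open scoped Classical

namespace Summit.QuantumAdvantage.QuantumAdvantage.Theorems.ShadowDial
open Finset
open Literature.Computability.QuantumComplexity Literature.Computability.QuantumComplexity.RingHLF
open Literature.Computability.MetaComplexity Literature.Computability.MetaComplexity.Smolensky
open Summit.QuantumAdvantage.AdviceFreeQNC0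
open Summit.QuantumAdvantage.QuantumAdvantage.Theorems.AnchorDial (outB dev loss_shape_mono)
open Summit.QuantumAdvantage.QuantumAdvantage.Theorems.HolonomyDial (tPoly tPoly_apply tPoly_mem xorP xorP_mem
  xorP_apply_bool mono_singleton_apply indP indP_apply indP_mem)
open Summit.QuantumAdvantage.QuantumAdvantage.Theorems.StabilizerDial (apIdx apStrat apStrat_mem apStrat_apply pad
  pad_mem rel_pad_iff winset_pad StabFew outB_pad_zero)
open Summit.QuantumAdvantage.QuantumAdvantage.Theorems.SparsityDial (real_loss_of_frac stabFew_mono_mr one_le_logpow)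
open Summit.QuantumAdvantage.QuantumAdvantage.Theorems.ResponseDial (mem_dev_apStrat dev_pad_zero
  not_polylogSparse_of_agree)
open Summit.QuantumAdvantage.QuantumAdvantage.Theorems.CounterDial (CounterForm StabCounter)
open Summit.QuantumAdvantage.QuantumAdvantage.Theorems.AbelianDial (alin TableForm StabTable AbelianLoss3
  NonAbelianLoss3 tableForm_of_counterForm nT pcell qcell pcell_val qcell_val pcell_injective qcell_injective
  pcell_ne_qcell qG qG_apply qG_indB qStrat qStrat_agree qStrat_mem6 q_in_dense_class mem_dev_q_second indB
  oddZeros_indB alin_indB q_not_tableForm_zero q_not_counterForm_zero)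
open Summit.QuantumAdvantage.QuantumAdvantage.Theorems.ScaleDial (logpow_add_logpow_le)

variable {N : ℕ}

/-! ## §4  THE `𝔽₂`-DEGREE CERTIFICATE ENGINE (Möbius top coefficient) and the TERNARY inhabitant `qStrat` -/

/-- **Möbius certificate over `𝔽₂`**: a function of `𝔽₂`-degree `< D` on `{0,1}^D` sums to `0` over the whole cube
(the top Möbius coefficient `c_{[D]}(g) = Σ_T (-1)^{D-|T|} g(1_T)` vanishes, and `-1 = 1`). -/
theorem cube_sum_eq_zero_of_lowDeg {D t : ℕ} {g : CubeFn (ZMod 2) D} (hg : g ∈ lowDeg (ZMod 2) D t) (ht : t < D) :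
    ∑ T ∈ (univ : Finset (Fin D)).powerset, g (indVec T) = 0 := by
  have h : mcoeff (univ : Finset (Fin D)) g = 0 :=
    mcoeff_eq_zero_of_mem_lowDegOn (F := ZMod 2) (by rw [← lowDeg_eq_lowDegOn]; exact hg)
      (by rw [card_univ, Fintype.card_fin]; exact ht)
  unfold mcoeff at h
  have h1 : ∀ k : ℕ, (-1 : ZMod 2) ^ k = 1 := fun k => by
    rw [show (-1 : ZMod 2) = 1 by decide, one_pow]
  simpa [h1] using h

/-- residue-class counts of the subset sizes of `s` modulo `3`. -/
def rc {α : Type*} (s : Finset α) (i : ℕ) : ℕ := (s.powerset.filter fun T => T.card % 3 = i).card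

/-- Pascal modulo 3: inserting a fresh element, `rc (insert a s) i = rc s i + rc s (i - 1 mod 3)`. -/
theorem rc_insert {α : Type*} [DecidableEq α] {a : α} {s : Finset α} (ha : a ∉ s) {i : ℕ} (hi : i < 3) :
    rc (insert a s) i = rc s i + rc s ((i + 2) % 3) := by
  unfold rc
  rw [Finset.powerset_insert, Finset.filter_union, Finset.card_union_of_disjoint]
  · congr 1
    rw [Finset.filter_image]
    rw [Finset.card_image_of_injOn]
    · congr 1
      refine Finset.filter_congr fun T hT => ?_
      have haT : a ∉ T := fun h => ha (Finset.mem_powerset.1 hT h)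
      simp only [Finset.card_insert_of_notMem haT]
      omega
    · intro T hT T' hT' h
      have hT0 := (Finset.mem_filter.1 (Finset.mem_coe.1 hT)).1
      have hT0' := (Finset.mem_filter.1 (Finset.mem_coe.1 hT')).1
      have haT : a ∉ T := fun h => ha (Finset.mem_powerset.1 hT0 h)
      have haT' : a ∉ T' := fun h => ha (Finset.mem_powerset.1 hT0' h)
      rw [← Finset.erase_insert haT, ← Finset.erase_insert haT', h]
  · rw [Finset.disjoint_left]
    intro T hT hT'
    rw [Finset.mem_filter] at hT hT'
    obtain ⟨T', hT'0, rfl⟩ := Finset.mem_image.1 hT'.1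
    exact ha (Finset.mem_powerset.1 hT.1 (Finset.mem_insert_self a T'))

/-- the three counts of the empty set. -/
theorem rc_empty {α : Type*} (i : ℕ) : rc (∅ : Finset α) i = if i = 0 then 1 else 0 := by
  unfold rc
  rw [Finset.powerset_empty]
  by_cases hi : i = 0
  · subst hi; simp [Finset.filter_singleton]
  · rw [if_neg hi]
    rw [Finset.card_eq_zero, Finset.filter_eq_empty_iff]
    intro T hT
    rw [Finset.mem_singleton.1 hT, Finset.card_empty]
    omega

/-- **parities of the residue-class counts** (period 3 from size 1 on): for nonempty `s`,
`#{T ⊆ s : |T| ≡ 0} ≡ [|s| ≢ 0]`, `#{|T| ≡ 1} ≡ [|s| ≢ 2]`, `#{|T| ≡ 2} ≡ [|s| ≢ 1]  (mod 2, residues mod 3)`. -/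
theorem rc_mod_two {α : Type*} [DecidableEq α] (s : Finset α) (hs : s.Nonempty) :
    rc s 0 % 2 = (if s.card % 3 = 0 then 0 else 1) ∧ rc s 1 % 2 = (if s.card % 3 = 2 then 0 else 1) ∧
      rc s 2 % 2 = (if s.card % 3 = 1 then 0 else 1) := by
  induction s using Finset.induction_on with
  | empty => exact absurd hs Finset.not_nonempty_empty
  | @insert a s ha ih =>
    rw [Finset.card_insert_of_notMem ha, rc_insert ha (show 0 < 3 by norm_num),
      rc_insert ha (show 1 < 3 by norm_num), rc_insert ha (show 2 < 3 by norm_num)]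
    norm_num only [Nat.reduceMod, Nat.reduceAdd]
    rcases s.eq_empty_or_nonempty with rfl | hne
    · simp [rc_empty]
    · obtain ⟨h0, h1, h2⟩ := ih hne
      have key : s.card % 3 = 0 ∨ s.card % 3 = 1 ∨ s.card % 3 = 2 := by omega
      rcases key with hm | hm | hm
      · have hm' : (s.card + 1) % 3 = 1 := by omega
        simp only [hm, hm'] at h0 h1 h2 ⊢
        norm_num at h0 h1 h2 ⊢
        omega
      · have hm' : (s.card + 1) % 3 = 2 := by omega
        simp only [hm, hm'] at h0 h1 h2 ⊢
        norm_num at h0 h1 h2 ⊢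
        omega
      · have hm' : (s.card + 1) % 3 = 0 := by omega
        simp only [hm, hm'] at h0 h1 h2 ⊢
        norm_num at h0 h1 h2 ⊢
        omega

/-- the count we need: for `1 ≤ |s|`, `3 ∤ |s|`, the number of `T ⊆ s` with `3 ∣ |T|` is ODD, and so is the number
with `3 ∤ |T|`. -/
theorem rc_zero_odd {α : Type*} [DecidableEq α] (s : Finset α) (hs : s.Nonempty) (h3 : s.card % 3 ≠ 0) :
    rc s 0 % 2 = 1 := by
  rw [(rc_mod_two s hs).1, if_neg h3]


/-- parity of the count of subsets by the class `xor c [3 ∣ |T|]`: odd for `1 ≤ D`, `3 ∤ D`, either `c`. -/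
theorem card_filter_xor_odd {D : ℕ} (hD1 : 1 ≤ D) (h3 : D % 3 ≠ 0) (c : Bool) :
    ((univ : Finset (Fin D)).powerset.filter fun T => xor c (decide (T.card % 3 = 0)) = true).card % 2 = 1 := by
  have hne : (univ : Finset (Fin D)).Nonempty := @univ_nonempty _ _ ⟨⟨0, hD1⟩⟩
  have hcard : (univ : Finset (Fin D)).card % 3 ≠ 0 := by rwa [card_univ, Fintype.card_fin]
  have h0 : rc (univ : Finset (Fin D)) 0 % 2 = 1 := rc_zero_odd _ hne hcard
  cases c
  · have e : ((univ : Finset (Fin D)).powerset.filter fun T => xor false (decide (T.card % 3 = 0)) = true) =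
        (univ : Finset (Fin D)).powerset.filter fun T => T.card % 3 = 0 :=
      filter_congr fun T _ => by simp
    rw [e]; exact h0
  · have e : ((univ : Finset (Fin D)).powerset.filter fun T => xor true (decide (T.card % 3 = 0)) = true) =
        (univ : Finset (Fin D)).powerset.filter fun T => ¬ (T.card % 3 = 0) :=
      filter_congr fun T _ => by simp
    rw [e]
    have hsplit := Finset.card_filter_add_card_filter_not (s := (univ : Finset (Fin D)).powerset)
      (fun T : Finset (Fin D) => T.card % 3 = 0)
    rw [card_powerset, card_univ, Fintype.card_fin] at hsplit
    have hrc : rc (univ : Finset (Fin D)) 0 = ((univ : Finset (Fin D)).powerset.filter fun T => T.card % 3 = 0).card :=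
      rfl
    obtain ⟨D', rfl⟩ := Nat.exists_eq_succ_of_ne_zero (show D ≠ 0 by omega)
    rw [pow_succ] at hsplit
    omega

section TernaryCertificate

/-! ### The matching family `qStrat` (g23) is ESSENTIALLY TERNARY: its shadow has linear `𝔽₂`-degree

At the last position `k₀ = N-1` the deviation gate is `[Q(x) ≡ 0 (3)]`, `Q = Σ_t x_{p_t} x_{q_t}`.  Restrict the output bit
to the sub-cube «`D` chosen odd cells free, their partner cells ON, everything else OFF»: it becomes
`u ↦ c ⊕ [|u| ≡ 0 (3)]` (`c` a constant canonical-guess bit), whose sum over `{0,1}^D` is `#{T : 3 ∣ |T|}` or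
`#{T : 3 ∤ |T|}` — ODD when `3 ∤ D` — whereas a function of `𝔽₂`-degree `< D` sums to zero
(`cube_sum_eq_zero_of_lowDeg`; substitution preserves degree, `Smolensky.comp_subst_mem_lowDeg`). -/

variable (k₀ : Fin N) {D : ℕ} (hD : D ≤ nT N)

/-- the cells switched ON at the free pattern `u`: the chosen odd cells `pcell j` with `u j`, and ALL `D` partner cells. -/
def qSet (u : Fin D → Bool) : Finset (Fin N) :=
  (univ.filter fun j : Fin D => u j = true).image (fun j => pcell (Fin.castLE hD j)) ∪
    univ.image (fun j : Fin D => qcell k₀ (Fin.castLE hD j))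

/-- the sub-cube embedding `u ↦ 1_{qSet u}`. -/
def qEmb (u : Fin D → Bool) : Fin N → Bool := indB (qSet k₀ hD u)

/-- an odd cell `pcell t` lies in the sub-cube point `qSet k₀ hD u` iff `t` is one of the `D` free pairs and its bit `u` is set. -/
theorem mem_qSet_pcell (u : Fin D → Bool) (t : Fin (nT N)) :
    pcell t ∈ qSet k₀ hD u ↔ ∃ j : Fin D, u j = true ∧ Fin.castLE hD j = t := by
  simp only [qSet, mem_union, mem_image, mem_filter, mem_univ, true_and]
  constructor
  · rintro (⟨j, hj, h⟩ | ⟨j, h⟩)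
    · exact ⟨j, hj, pcell_injective h⟩
    · exact absurd h.symm (pcell_ne_qcell k₀ t _)
  · rintro ⟨j, hj, rfl⟩
    exact Or.inl ⟨j, hj, rfl⟩

/-- an even partner cell `qcell k₀ t` lies in `qSet k₀ hD u` iff `t < D` (the partners of the free pairs are ON). -/
theorem mem_qSet_qcell (u : Fin D → Bool) (t : Fin (nT N)) :
    qcell k₀ t ∈ qSet k₀ hD u ↔ t.val < D := by
  simp only [qSet, mem_union, mem_image, mem_filter, mem_univ, true_and]
  constructor
  · rintro (⟨j, -, h⟩ | ⟨j, h⟩)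
    · exact absurd h (pcell_ne_qcell k₀ _ t)
    · have := congrArg Fin.val (qcell_injective k₀ h)
      simp only [Fin.val_castLE] at this
      omega
  · intro h
    exact Or.inr ⟨⟨t.val, h⟩, congrArg _ (Fin.ext rfl)⟩

/-- cells other than the free odd cells have a pattern-independent status. -/
theorem mem_qSet_of_ne (i : Fin N) (hi : ∀ j : Fin D, i ≠ pcell (Fin.castLE hD j)) (u u' : Fin D → Bool) :
    i ∈ qSet k₀ hD u ↔ i ∈ qSet k₀ hD u' := by
  simp only [qSet, mem_union, mem_image, mem_filter, mem_univ, true_and]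
  constructor
  · rintro (⟨j, -, h⟩ | h)
    · exact absurd h.symm (hi j)
    · exact Or.inr h
  · rintro (⟨j, -, h⟩ | h)
    · exact absurd h.symm (hi j)
    · exact Or.inr h

/-- the free odd cell `j` carries the variable `u j`. -/
theorem qEmb_apply_pcell (u : Fin D → Bool) (j : Fin D) : qEmb k₀ hD u (pcell (Fin.castLE hD j)) = u j := by
  unfold qEmb indB
  have e : (∃ j' : Fin D, u j' = true ∧ Fin.castLE hD j' = Fin.castLE hD j) ↔ u j = true :=
    ⟨fun ⟨j', h1, h2⟩ => Fin.castLE_injective hD h2 ▸ h1, fun h => ⟨j, h, rfl⟩⟩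
  rw [Bool.decide_congr ((mem_qSet_pcell k₀ hD u _).trans e), Bool.decide_eq_true]

/-- every coordinate of the embedding is a constant or a variable (a substitution of variables). -/
theorem qEmb_subst : ∀ i : Fin N, (∃ b, ∀ u, qEmb k₀ hD u i = b) ∨ (∃ j, ∀ u, qEmb k₀ hD u i = u j) := by
  intro i
  by_cases h : ∃ j : Fin D, i = pcell (Fin.castLE hD j)
  · obtain ⟨j, rfl⟩ := h
    exact Or.inr ⟨j, fun u => qEmb_apply_pcell k₀ hD u j⟩
  · push Not at h
    refine Or.inl ⟨qEmb k₀ hD (fun _ => false) i, fun u => ?_⟩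
    unfold qEmb indB
    exact Bool.decide_congr (mem_qSet_of_ne k₀ hD i h u _)

/-- on the sub-cube the matching count is the WEIGHT of the free pattern. -/
theorem qG_qEmb (u : Fin D → Bool) :
    qG k₀ (qEmb k₀ hD u) = ((univ.filter fun j : Fin D => u j = true).card : ZMod 3) := by
  unfold qEmb
  rw [qG_indB]
  have key : ∀ t : Fin (nT N), (pcell t ∈ qSet k₀ hD u ∧ qcell k₀ t ∈ qSet k₀ hD u) ↔
      t ∈ (univ.filter fun j : Fin D => u j = true).image (Fin.castLE hD) := by
    intro t
    rw [mem_qSet_pcell, mem_qSet_qcell, mem_image]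
    constructor
    · rintro ⟨⟨j, hj, rfl⟩, -⟩
      exact ⟨j, mem_filter.2 ⟨mem_univ _, hj⟩, rfl⟩
    · rintro ⟨j, hj, rfl⟩
      exact ⟨⟨j, (mem_filter.1 hj).2, rfl⟩, by simp only [Fin.val_castLE]; exact j.isLt⟩
  rw [Finset.sum_boole]
  have e : (univ.filter fun t : Fin (nT N) => pcell t ∈ qSet k₀ hD u ∧ qcell k₀ t ∈ qSet k₀ hD u) =
      (univ.filter fun j : Fin D => u j = true).image (Fin.castLE hD) := by
    ext t; simp only [mem_filter, mem_univ, true_and, key]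
  rw [e, card_image_of_injective _ (Fin.castLE_injective hD)]

/-- the shadow of the matching family outside the first half-cycle: `t_k(y) ⊕ [Q_k(y) ≡ 0]`. -/
theorem shadow_q_second (y : Fin N → Bool) (k : Fin N) (hk : ¬ (1 ≤ k.val ∧ k.val < N / 2)) :
    shadow (fun i : Fin N => qStrat i) k y = if xor (tGuess y k) (decide (qG k y = 0)) then 1 else 0 := by
  have happ : qStrat k y = if xor (tGuess y k) (decide (qG k y = 0)) then 1 else 0 := by
    unfold qStrat; rw [if_neg hk]
    exact xorP_apply_bool _ _ y _ _ (tPoly_apply k y) (by rw [indP_apply]; by_cases h : qG k y = 0 <;> simp [h])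
  show (if qStrat k y = 1 then (1 : ZMod 2) else 0) = _
  rw [happ]
  cases xor (tGuess y k) (decide (qG k y = 0)) <;> simp

/-- the canonical-guess bit at the last position is CONSTANT on the sub-cube (cells `N-1` and `0` are not free). -/
theorem tGuess_qEmb (hN : 3 ≤ N) (u : Fin D → Bool) :
    tGuess (qEmb ⟨N - 1, by omega⟩ hD u) ⟨N - 1, by omega⟩ =
      tGuess (qEmb ⟨N - 1, by omega⟩ hD (fun _ => false)) ⟨N - 1, by omega⟩ := by
  have hfree : ∀ (i : Fin N), (i.val = N - 1 ∨ i.val = 0) → ∀ j : Fin D, i ≠ pcell (Fin.castLE hD j) := by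
    intro i hi j h
    have h1 := congrArg Fin.val h
    rw [pcell_val] at h1
    have h2 := (Fin.castLE hD j).isLt
    simp only [Fin.val_castLE] at h1 h2
    unfold nT at h2
    omega
  unfold tGuess qEmb indB
  have hn : (nxt (⟨N - 1, by omega⟩ : Fin N)).val = 0 := by
    show (N - 1 + 1) % N = 0
    rw [Nat.sub_add_cancel (by omega), Nat.mod_self]
  rw [Bool.decide_congr (mem_qSet_of_ne _ hD _ (hfree _ (Or.inl rfl)) u (fun _ => false)),
    Bool.decide_congr (mem_qSet_of_ne _ hD _ (hfree _ (Or.inr hn)) u (fun _ => false))]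

/-- **★ THE TERNARY CERTIFICATE**: for `1 ≤ D ≤ T`, `3 ∤ D`, the shadow of the matching family at position `N-1` (zero
gauge) is NOT an `𝔽₂`-polynomial of degree `< D`.  (Hence its `𝔽₂`-degree is `≥ T - 1 ≥ (N-1)/2 - 2`: LINEAR.) -/
theorem q_shadow_not_lowDeg (hD : D ≤ nT N) (hN : 3 ≤ N) {t : ℕ} (hD1 : 1 ≤ D) (h3 : D % 3 ≠ 0) (ht : t < D)
    (hlow : shadow (pad (fun i : Fin N => qStrat i) (fun _ => 0)) ⟨N - 1, by omega⟩ ∈ lowDeg (ZMod 2) N t) :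
    False := by
  set k₀ : Fin N := ⟨N - 1, by omega⟩ with hk₀
  have hk : ¬ (1 ≤ k₀.val ∧ k₀.val < N / 2) := by simp only [hk₀]; omega
  rw [shadow_pad_zero] at hlow
  have hg : (fun u : Fin D → Bool => shadow (fun i : Fin N => qStrat i) k₀ (qEmb k₀ hD u)) ∈ lowDeg (ZMod 2) D t :=
    comp_subst_mem_lowDeg (qEmb k₀ hD) (qEmb_subst k₀ hD) hlow
  have hsum := cube_sum_eq_zero_of_lowDeg hg ht
  set c : Bool := tGuess (qEmb k₀ hD (fun _ => false)) k₀ with hc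
  have hval : ∀ T : Finset (Fin D), shadow (fun i : Fin N => qStrat i) k₀ (qEmb k₀ hD (indVec T)) =
      if xor c (decide (T.card % 3 = 0)) then 1 else 0 := by
    intro T
    rw [shadow_q_second _ _ hk, hk₀, tGuess_qEmb hD hN, ← hk₀, qG_qEmb]
    have hT : (univ.filter fun j : Fin D => indVec T j = true) = T := by
      ext j; simp [indVec]
    rw [hT, Bool.decide_congr ((ZMod.natCast_eq_zero_iff T.card 3).trans Nat.dvd_iff_mod_eq_zero)]
  simp only [hval] at hsum
  rw [Finset.sum_boole] at hsum
  have hodd := card_filter_xor_odd hD1 h3 c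
  rw [(ZMod.natCast_eq_zero_iff _ 2).trans Nat.dvd_iff_mod_eq_zero] at hsum
  omega

end TernaryCertificate

/-- the LINEAR form: for `N ≥ 9` the shadow at position `N-1` has `𝔽₂`-degree `> (N-1)/2 - 3`. -/
theorem q_shadow_degree_linear (hN9 : 9 ≤ N) :
    shadow (pad (fun i : Fin N => qStrat i) (fun _ => 0)) ⟨N - 1, by omega⟩ ∉ lowDeg (ZMod 2) N ((N - 1) / 2 - 3) := by
  intro h
  have hN : 3 ≤ N := by omega
  have hT : 4 ≤ nT N := by unfold nT; omega
  have hTe : nT N = (N - 1) / 2 := rfl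
  by_cases h3 : nT N % 3 = 0
  · have hD : nT N - 1 ≤ nT N := by omega
    have hD1 : 1 ≤ nT N - 1 := by omega
    have h3' : (nT N - 1) % 3 ≠ 0 := by omega
    have ht : (N - 1) / 2 - 3 < nT N - 1 := by omega
    exact q_shadow_not_lowDeg hD hN hD1 h3' ht h
  · have ht : (N - 1) / 2 - 3 < nT N := by omega
    exact q_shadow_not_lowDeg le_rfl hN (by omega) h3 ht h


/-- **the matching family is NOT cheaply-`𝔽₂`-low at the zero gauge, for EVERY shadow exponent `e'`** (eventually in `n`):
`(log₂ n)^e' < (n-1)/2 - 3` for large `n` (`ScaleDial.logpow_add_logpow_le`). With g23's certificates (`q_in_dense_class`,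
`q_not_counterForm_zero`, `q_not_tableForm_zero`) it inhabits the residual's hypothesis class at the zero gauge. -/
theorem q_not_F2low_zero (e' : ℕ) : ∃ n₀ : ℕ, ∀ n ≥ n₀,
    ¬ ∀ k : Fin n, shadow (pad (fun i : Fin n => qStrat i) (fun _ => 0)) k ∈ lowDeg (ZMod 2) n ((Nat.log 2 n) ^ e') := by
  refine ⟨max (2 ^ (2 ^ (e' + (e' + 1) + 2))) 16, fun n hn h => ?_⟩
  have hn16 : 16 ≤ n := le_trans (le_max_right _ _) hn
  have hgrow : (Nat.log 2 n) ^ e' + (Nat.log 2 n) ^ (e' + 1) ≤ n - 1 :=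
    logpow_add_logpow_le (A := e') (B := e' + 1) (n := n) (le_trans (le_max_left _ _) hn)
  have hL : 4 ≤ Nat.log 2 n := Nat.le_log_of_pow_le (by norm_num) (by omega)
  have h4 : 4 * (Nat.log 2 n) ^ e' ≤ (Nat.log 2 n) ^ (e' + 1) := by
    rw [pow_succ, mul_comm]
    exact Nat.mul_le_mul_left _ hL
  have hlt : (Nat.log 2 n) ^ e' ≤ (n - 1) / 2 - 3 := by omega
  have hN9 : 9 ≤ n := by omega
  exact q_shadow_degree_linear hN9 (lowDeg_mono hlt (h ⟨n - 1, by omega⟩))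


end Summit.QuantumAdvantage.QuantumAdvantage.Theorems.ShadowDial
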